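import Literature.AlgebraicTopology.Homotopy.SerreFibrationCell
import Literature.AlgebraicTopology.Homotopy.SerreFibrationCubeCap
import HarnessLib

/-!
# Serre fibrations over one cell: `H_{k+s}(p⁻¹ē, p⁻¹ė) ≅ H_k(fibre)` compatibly with cap products

Topic `Literature/AlgebraicTopology/Homotopy`, sibling of `SerreFibrationCell.lean` (E. H. Spanier,
*Algebraic Topology* (1981), Ch. 9, Sec. 2, Thm. 15 (a), "`ψ_* : H_s(e, ė; Hₙ(F)) ≈
H_{n+s}(p⁻¹(e), p⁻¹(ė))`", for Serre fibrations over a Hausdorff CW complex, in naturality form)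
and of `SerreFibrationCubeCap.lean` (the cube step with cap products). For a Serre fibration
`p : E → X`, an `s`-cell `eⱼ` with centre `Φⱼ0`, and a class `η ∈ H²(E; R)`, the chain of
isomorphisms of `SerreCell.transfer_aux` — `(p⁻¹ēⱼ, p⁻¹ėⱼ) → (p⁻¹ēⱼ, p⁻¹(ēⱼ ∩ collar))`
(`CellsDirectSum.Serre.isIso_b`), the projection of pairs from the pull-back `Q` over the ball of
radius `¾` (`SerreCell.isIso_map_proj`), the cube (`SerreCube.exists_conj_cap`) and the weak
equivalence `p⁻¹(Φⱼ0) ↪ Q` (`SerreCell.isWeakHomotopyEquiv_fibreIncl`) — consists of maps of pairs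
and connecting maps, hence commutes with the cap products by the restrictions of `η` (Hatcher
2002, §3.3 p. 241, projection formula; p. 240, boundary formula). Result:

* `SerreCell.exists_conj_cap` — `R`-linear bijections
  `φ_k : H_{k+s}(p⁻¹ēⱼ, p⁻¹ėⱼ; R) → H_k(p⁻¹(Φⱼ0); R)` with
  `φ_k (η|_{p⁻¹ēⱼ} ⌢ x) = η|_{p⁻¹(Φⱼ0)} ⌢ φ_{k+2} x`.

This is the single-cell step of hard Lefschetz on the `E¹`-term of the Leray–Serre spectral
sequence of a projective family (C. Voisin, *Hodge Theory and Complex Algebraic Geometry II* (2003),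
proof of Thm. 4.15), in the homological cap-product form of the tree. Everything is proved; no
named fact is introduced.

## References

* E. H. Spanier, *Algebraic Topology*, Springer (1981), Ch. 9, Sec. 2, Lemma 2, Thm. 15 (a).
  [Spanier1981]
* A. Hatcher, *Algebraic Topology*, CUP (2002), §3.3 pp. 239–241. [HatcherAT2002]
* C. Voisin, *Hodge Theory and Complex Algebraic Geometry II*, CUP (2003), Lemma 4.13, Thm. 4.15.
  [VoisinHodgeII2003]
-/

noncomputable section

open Set Function Metric unitInterval CategoryTheory CategoryTheory.Limits
open scoped Topology unitInterval
open Literature.AlgebraicTopology.SingularHomology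

namespace Literature.AlgebraicTopology.Homotopy

universe u v uR

namespace SerreCell

open _root_.Topology RelCWComplex SkeletonCollar CellsDirectSum

variable {X : Type v} [TopologicalSpace X] [T2Space X] [CWComplex (univ : Set X)] {s : ℕ}
variable (R : Type uR) [CommRing R]
variable {E : Type u} [TopologicalSpace E] {p : E → X} (j : cell (univ : Set X) s)
  (η : singularCohomology R R E 2)

omit [T2Space X] in
/-- The composite `p⁻¹(Φⱼ0) → Q → p⁻¹ēⱼ → E` is the inclusion. [folklore] -/
theorem subsetIncl_comp_proj_comp_fibreIncl :
    ((subsetIncl (p ⁻¹' closedCell s j)).comp (proj p j)).comp (fibreIncl p j) =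
      subsetIncl (p ⁻¹' {map s j 0}) :=
  ContinuousMap.ext fun _ => rfl

omit [T2Space X] in
/-- `η|_{p⁻¹ēⱼ}` pulled back to `Q` and then to the fibre over the centre is `η|_{p⁻¹(Φⱼ0)}`.
[folklore] -/
theorem map_fibreIncl_map_proj_restrict :
    singularCohomology.map R R (fibreIncl p j) 2 (singularCohomology.map R R (proj p j) 2
        (singularCohomology.map R R (subsetIncl (p ⁻¹' closedCell s j)) 2 η)) =
      singularCohomology.map R R (subsetIncl (p ⁻¹' {map s j 0})) 2 η := by
  change ((singularCohomology.map R R (subsetIncl (p ⁻¹' closedCell s j)) 2 ≫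
    singularCohomology.map R R (proj p j) 2) ≫ singularCohomology.map R R (fibreIncl p j) 2) η = _
  rw [← singularCohomology.map_comp, ← singularCohomology.map_comp, subsetIncl_comp_proj_comp_fibreIncl]

/-- **Spanier's Thm. 9.2.15 (a) over one cell, cap-product form.** For a Serre fibration
`p : E → X` over a Hausdorff CW complex, an `s`-cell `eⱼ` and `η ∈ H²(E; R)`, there are `R`-linear
bijections `φ_k : H_{k+s}(p⁻¹ēⱼ, p⁻¹ėⱼ; R) → H_k(p⁻¹(Φⱼ0); R)` with
`φ_k (η|_{p⁻¹ēⱼ} ⌢ x) = η|_{p⁻¹(Φⱼ0)} ⌢ φ_{k+2} x`.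
[cite: Spanier1981, Ch. 9, Sec. 2, Thm. 15 (a); VoisinHodgeII2003, Thm. 4.15 (proof)] -/
theorem exists_conj_cap (hp : IsSerreFibration p) :
    ∃ φ : ∀ k, relativeSingularHomology R R (Cl p j) (fr p j) (k + s) →ₗ[R]
        singularHomology R R ↥(p ⁻¹' {map s j 0}) k,
      (∀ k, Function.Bijective (φ k)) ∧
      ∀ (k : ℕ) (x : relativeSingularHomology R R (Cl p j) (fr p j) (k + 2 + s)),
        φ k (relCapProduct (fr p j) (show 2 + (k + s) = k + 2 + s by omega)
            (singularCohomology.map R R (subsetIncl (p ⁻¹' closedCell s j)) 2 η) x) =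
          capProduct (show 2 + k = k + 2 by omega)
            (singularCohomology.map R R (subsetIncl (p ⁻¹' {map s j 0})) 2 η) (φ (k + 2) x) := by
  -- notation for the classes
  set θ := singularCohomology.map R R (subsetIncl (p ⁻¹' closedCell s j)) 2 η with hθ
  set θQ := singularCohomology.map R R (proj p j) 2 θ with hθQ
  have hθF : singularCohomology.map R R (fibreIncl p j) 2 θQ =
      singularCohomology.map R R (subsetIncl (p ⁻¹' {map s j 0})) 2 η :=
    map_fibreIncl_map_proj_restrict R j η
  -- (1) `(Cl, fr) → (Cl, an)` along `b`
  haveI := fun n => Serre.isIso_b R hp j n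
  let eb : ∀ n, relativeSingularHomology R R (Cl p j) (fr p j) n ≃ₗ[R]
      relativeSingularHomology R R (Cl p j) (an p j) n := fun n =>
    (asIso (relativeSingularHomology.map R R (ContinuousMap.id (Cl p j))
      (mapsTo_id_of_subset (fr_subset_an j)) n)).toLinearEquiv
  have heb : ∀ n x, eb n x = relativeSingularHomology.map R R (ContinuousMap.id (Cl p j))
      (mapsTo_id_of_subset (fr_subset_an j)) n x := fun n x => rfl
  -- (2) `(Q, QS) → (Cl, an)` along `Π`
  haveI := fun n => isIso_map_proj j hp R n
  let eP : ∀ n, relativeSingularHomology R R (Q p j) (QS p j) n ≃ₗ[R]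
      relativeSingularHomology R R (Cl p j) (an p j) n := fun n =>
    (asIso (relativeSingularHomology.map R R (proj p j) (mapsTo_proj_QS (p := p) j) n)).toLinearEquiv
  have heP : ∀ n x, eP n x = relativeSingularHomology.map R R (proj p j)
      (mapsTo_proj_QS (p := p) j) n x := fun n x => rfl
  -- (3) the cube theorem for `Q → Iˢ`
  obtain ⟨φQ, hφQ, hcommQ⟩ := SerreCube.conj_cap_aux R s (isSerreFibration_qmap j hp)
    (qmap_preimage_boundary (p := p) j).symm θQ
  -- (4) the fibre over the centre includes into `Q` by a weak equivalence
  haveI := fun k => isIso_singularHomology_map_of_isWeakHomotopyEquiv (R := R) (fibreIncl p j)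
    (isWeakHomotopyEquiv_fibreIncl j hp) k
  let eF : ∀ k, singularHomology R R ↥(p ⁻¹' {map s j 0}) k ≃ₗ[R] singularHomology R R (Q p j) k :=
    fun k => (asIso (singularHomology.map R R (fibreIncl p j) k)).toLinearEquiv
  have heF : ∀ k c, eF k c = singularHomology.map R R (fibreIncl p j) k c := fun k c => rfl
  refine ⟨fun k => (eF k).symm.toLinearMap ∘ₗ φQ k ∘ₗ (eP (k + s)).symm.toLinearMap ∘ₗ
    (eb (k + s)).toLinearMap, fun k => ?_, fun k x => ?_⟩
  · exact (eF k).symm.bijective.comp ((hφQ k).comp ((eP (k + s)).symm.bijective.comp (eb (k + s)).bijective))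
  · change (eF k).symm (φQ k ((eP (k + s)).symm (eb (k + s) (relCapProduct (fr p j) _ θ x)))) =
      capProduct _ (singularCohomology.map R R (subsetIncl (p ⁻¹' {map s j 0})) 2 η)
        ((eF (k + 2)).symm (φQ (k + 2) ((eP (k + 2 + s)).symm (eb (k + 2 + s) x))))
    -- (1) `b`
    have h1 : eb (k + s) (relCapProduct (fr p j) (show 2 + (k + s) = k + 2 + s by omega) θ x) =
        relCapProduct (an p j) (show 2 + (k + s) = k + 2 + s by omega) θ (eb (k + 2 + s) x) := by
      rw [heb, heb, ← relativeSingularHomology.map_relCapProduct, singularCohomology.map_id]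
      rfl
    -- (2) `Π⁻¹`
    have h2 : ∀ w, (eP (k + s)).symm (relCapProduct (an p j) (show 2 + (k + s) = k + 2 + s by omega) θ w) =
        relCapProduct (QS p j) (show 2 + (k + s) = k + 2 + s by omega) θQ ((eP (k + 2 + s)).symm w) :=
      fun w => by
      apply (eP (k + s)).injective
      rw [LinearEquiv.apply_symm_apply, heP, relativeSingularHomology.map_relCapProduct, ← heP,
        LinearEquiv.apply_symm_apply]
    -- (4) `fibreIncl⁻¹`
    have h4 : ∀ c, (eF k).symm (capProduct (show 2 + k = k + 2 by omega) θQ c) =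
        capProduct (show 2 + k = k + 2 by omega)
          (singularCohomology.map R R (subsetIncl (p ⁻¹' {map s j 0})) 2 η) ((eF (k + 2)).symm c) :=
      fun c => by
      apply (eF k).injective
      rw [LinearEquiv.apply_symm_apply, heF, ← hθF, capProduct_map, ← heF, LinearEquiv.apply_symm_apply]
    rw [h1, h2, hcommQ k, h4]

end SerreCell

end Literature.AlgebraicTopology.Homotopy
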